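import Summits.AtomisticToContinuum.FouriersLaw.Theorems.PhononMeanFreePathIncoherentChannelLightConeHelper8
import Summits.AtomisticToContinuum.FouriersLaw.Theorems.PhononMeanFreePathIncoherentChannelCommonPastBoundHelper1
import Literature.MathematicalPhysics.KineticTheory.LangevinChainScalingLimit

/-!
# `IncoherentChannel`, line `two-horizons-forecast-loss` — contact loss of the forecast norm, helper 1

First of three files proving the `N`-UNIFORM CONTACT LOSS of the forecast norm `S_N(t) = fnorm … N t = ‖K_t p_N‖²_{L²(μ₀)}`
(the object of the lead's stub `stub_forecastLoss`, crux `PhononMeanFreePath.IncoherentChannel`,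
stmt-AtomisticToContinuum-11811, route `PhononMeanFreePath`, sub-problem `FouriersLaw`; vocabulary `PhononMeanFreePathDefs`),
for the `(N+1)`-site pinned chain `pinnedChain ω₂ lam β γ` with both baths at `T` (CONSTRUCTED kernels `solMap` /
`transitionKernel`, Gibbs law `gibbsMeasure`). This file supplies the three model inputs of the computation on the
product space `μ₀ ⊗ W` (initial Gibbs state × pair of bath Brownian motions):

* `contactLoss_map_solMap_prod`, `contactLoss_integral_solMap_prod` — STATIONARITY as a push-forward identity
  `(μ₀ ⊗ W).map Φ_r = μ₀` (Gibbs invariance of the constructed kernels), with the Bochner transfer;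
* `contactLoss_momentum_sde` — the `p_N`-component of the pathwise Langevin equation along the solution map:
  `p_N(t) = p_N(0) + √(2γT) B²_t (+ √(2γT) B¹_t on the one-site chain) + ∫₀ᵗ Y_N(z_s) ds`;
* `contactLoss_drift_last_eq`, `contactLoss_drift_last_sq_le`, `contactLoss_drift_last_sq_gibbs` — the drift at the
  bath site `Y_N = −U'(q_N) − [N ≥ 1]V'(q_N − q_{N−1}) − γ w_N p_N` in closed form, the pointwise bound
  `Y_N² ≤ A(q_N² + q_N⁶ + q_{N−1}² + q_{N−1}⁶ + p_N²)` and its `N`-UNIFORM Gibbs second moment (position moments of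
  `LightConeHelper5`, equipartition).

No definitions; nothing here closes an item.
-/

noncomputable section

namespace Summit.AtomisticToContinuum.FouriersLaw.Theorems.PhononMeanFreePath

open MeasureTheory ProbabilityTheory Set Filter Topology
open scoped NNReal ENNReal
open Literature.MathematicalPhysics.KineticTheory.HeatConduction
open Literature.MathematicalPhysics.KineticTheory Literature.Probability.Process OscillatorChain

/-! ### Stationarity of the kernel process on the product space `μ₀ ⊗ W` -/

section Stationarity

variable {ω₂ lam β γ T : ℝ} (hω : 0 < ω₂) (hl : 0 ≤ lam) (hβ : 0 ≤ β) (hγ : 0 ≤ γ) (hT : 0 < T) (N : ℕ)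
include hω hl hβ hγ hT

/-- **Stationarity as a push-forward identity**: under `μ₀ ⊗ W` the state at time `r ≥ 0` of the solution
map started from the Gibbs state has law `μ₀`: `(μ₀ ⊗ W).map (Φ_r) = μ₀`.
[cite: CuneoEckmannHairerReyBellet2018, §3.1] -/
theorem contactLoss_map_solMap_prod (r : ℝ≥0) :
    (((pinnedChain ω₂ lam β γ).gibbsMeasure (N + 1) T).prod wienerPair).map
        (fun p : PhaseSpace (N + 1) × WienerPair =>
          (pinnedChain ω₂ lam β γ).solMap (N + 1) T T r p.1 (pairPath p.2)) =
      (pinnedChain ω₂ lam β γ).gibbsMeasure (N + 1) T := by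
  set μ₀ := (pinnedChain ω₂ lam β γ).gibbsMeasure (N + 1) T with hμ₀
  set f : PhaseSpace (N + 1) × WienerPair → PhaseSpace (N + 1) := fun p =>
    (pinnedChain ω₂ lam β γ).solMap (N + 1) T T r p.1 (pairPath p.2) with hf
  have hm : Measurable f := pinnedChain_measurable_solMap_pairPath hω hl hβ hγ (N + 1) T T (r : ℝ)
  refine Measure.ext fun A hA => ?_
  rw [Measure.map_apply hm hA, ← lintegral_indicator_one (hm hA)]
  have hg : Measurable (A.indicator (1 : PhaseSpace (N + 1) → ℝ≥0∞)) := measurable_one.indicator hA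
  have e : (f ⁻¹' A).indicator (1 : PhaseSpace (N + 1) × WienerPair → ℝ≥0∞) =
      fun p => A.indicator (1 : PhaseSpace (N + 1) → ℝ≥0∞) (f p) := by
    funext p
    by_cases hp : f p ∈ A
    · rw [Set.indicator_of_mem hp, Set.indicator_of_mem (show p ∈ f ⁻¹' A from hp)]; rfl
    · rw [Set.indicator_of_notMem hp, Set.indicator_of_notMem (show p ∉ f ⁻¹' A from hp)]
  rw [e, lintegral_prod (fun p : PhaseSpace (N + 1) × WienerPair => A.indicator (1 : PhaseSpace (N + 1) → ℝ≥0∞) (f p))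
    (hg.comp hm).aemeasurable]
  have h2 := lightCone_lintegral_solMap_gibbs hω hl hβ hγ N hT r hg
  simp only [hf] at h2 ⊢
  rw [h2, lintegral_indicator_one hA]

/-- Stationarity, Bochner form: for `g ∈ L¹(μ₀)`, `g(Φ_r) ∈ L¹(μ₀ ⊗ W)` and `∫ g(Φ_r) d(μ₀ ⊗ W) = ∫ g dμ₀`.
[cite: CuneoEckmannHairerReyBellet2018, §3.1] -/
theorem contactLoss_integral_solMap_prod (r : ℝ≥0) {g : PhaseSpace (N + 1) → ℝ}
    (hgm : StronglyMeasurable g) (hg : Integrable g ((pinnedChain ω₂ lam β γ).gibbsMeasure (N + 1) T)) :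
    Integrable (fun p : PhaseSpace (N + 1) × WienerPair =>
        g ((pinnedChain ω₂ lam β γ).solMap (N + 1) T T r p.1 (pairPath p.2)))
        (((pinnedChain ω₂ lam β γ).gibbsMeasure (N + 1) T).prod wienerPair) ∧
      ∫ p, g ((pinnedChain ω₂ lam β γ).solMap (N + 1) T T r p.1 (pairPath p.2))
          ∂(((pinnedChain ω₂ lam β γ).gibbsMeasure (N + 1) T).prod wienerPair) =
        ∫ z, g z ∂((pinnedChain ω₂ lam β γ).gibbsMeasure (N + 1) T) := by
  have hmap := contactLoss_map_solMap_prod hω hl hβ hγ hT N r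
  have hm := pinnedChain_measurable_solMap_pairPath hω hl hβ hγ (N + 1) T T (r : ℝ)
  have hgm' : AEStronglyMeasurable g ((((pinnedChain ω₂ lam β γ).gibbsMeasure (N + 1) T).prod wienerPair).map
      fun p : PhaseSpace (N + 1) × WienerPair =>
        (pinnedChain ω₂ lam β γ).solMap (N + 1) T T r p.1 (pairPath p.2)) := by
    rw [hmap]; exact hgm.aestronglyMeasurable
  refine ⟨?_, ?_⟩
  · have h := (integrable_map_measure hgm' hm.aemeasurable).1 (by rw [hmap]; exact hg)
    exact h
  · rw [← integral_map hm.aemeasurable hgm', hmap]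

end Stationarity

/-! ### The pathwise SDE of the bath momentum -/

section SDE

variable {ω₂ lam β γ : ℝ} (hω : 0 < ω₂) (hl : 0 ≤ lam) (hβ : 0 ≤ β) (hγ : 0 ≤ γ) (T : ℝ) (N : ℕ)
include hω hl hβ hγ

/-- **The bath momentum along the solution map, in integral form** (the `p_N`-component of the pathwise
Langevin equation (IE) driven by the Brownian pair): for `t ≥ 0`,
`p_N(t) = p_N(0) + √(2γT)·B²_t (+ √(2γT)·B¹_t on the one-site chain) + ∫₀ᵗ Y_N(z_s) ds`, `Y` the drift.
[cite: CuneoEckmannHairerReyBellet2018, §2 eq. (2.2)] -/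
theorem contactLoss_momentum_sde {t : ℝ} (ht : 0 ≤ t) (z : PhaseSpace (N + 1)) (ω : WienerPair) :
    ((pinnedChain ω₂ lam β γ).solMap (N + 1) T T t z (pairPath ω)).2 (Fin.last N) =
      z.2 (Fin.last N) +
        ((if (Fin.last N).val = 0 then Real.sqrt (2 * γ * T) else 0) * brownian t.toNNReal ω.1 +
          Real.sqrt (2 * γ * T) * brownian t.toNNReal ω.2) +
        ∫ s in (0 : ℝ)..t, ((pinnedChain ω₂ lam β γ).drift (N + 1)
          ((pinnedChain ω₂ lam β γ).solMap (N + 1) T T s z (pairPath ω))).2 (Fin.last N) := by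
  -- the noise path of the Brownian pair and the flow it drives (`solMap` unfolded)
  have hηc : Continuous (chainNoise (N + 1) (Real.sqrt (2 * γ * T)) (Real.sqrt (2 * γ * T)) (pairPath ω)) :=
    continuous_chainNoise _ _ (pairPath ω)
  have hsol : ∀ s, (pinnedChain ω₂ lam β γ).solMap (N + 1) T T s z (pairPath ω) =
      (pinnedChain ω₂ lam β γ).chainFlow (N + 1) z
        (chainNoise (N + 1) (Real.sqrt (2 * γ * T)) (Real.sqrt (2 * γ * T)) (pairPath ω)) s := fun s => rfl
  have hYc : Continuous ((pinnedChain ω₂ lam β γ).drift (N + 1)) :=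
    (pinnedChain_contDiff_drift ω₂ lam β γ (N + 1) (n := 0)).continuous
  have hzc := pinnedChain_continuous_chainFlow hω hl hβ hγ (N + 1) z hηc
  have hz_eq := pinnedChain_isIntegralSolutionOn_chainFlow hω hl hβ hγ (N + 1) z hηc t t ⟨ht, le_rfl⟩
  -- apply the coordinate functional `x ↦ x.2 (last N)`
  have hint : IntervalIntegrable (fun r => (pinnedChain ω₂ lam β γ).drift (N + 1)
      ((pinnedChain ω₂ lam β γ).chainFlow (N + 1) z
        (chainNoise (N + 1) (Real.sqrt (2 * γ * T)) (Real.sqrt (2 * γ * T)) (pairPath ω)) r)) volume 0 t :=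
    ((hYc.comp hzc).intervalIntegrable _ _)
  have h1 := congrArg ((ContinuousLinearMap.proj (Fin.last N)).comp
    (ContinuousLinearMap.snd ℝ (Fin (N + 1) → ℝ) (Fin (N + 1) → ℝ))) hz_eq
  rw [map_add, ← ContinuousLinearMap.intervalIntegral_comp_comm _ hint] at h1
  simp only [ContinuousLinearMap.coe_comp, Function.comp_apply, ContinuousLinearMap.coe_snd',
    ContinuousLinearMap.proj_apply] at h1
  simp only [hsol]
  rw [h1]
  have hforce : (forcing z (chainNoise (N + 1) (Real.sqrt (2 * γ * T)) (Real.sqrt (2 * γ * T)) (pairPath ω)) t).2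
      (Fin.last N) = z.2 (Fin.last N) +
        chainNoise (N + 1) (Real.sqrt (2 * γ * T)) (Real.sqrt (2 * γ * T)) (pairPath ω) t (Fin.last N) := by
    simp [forcing]
  rw [hforce, chainNoise_pairPath]
  have hlast : (Fin.last N).val = N + 1 - 1 := by simp
  simp only [hlast, if_true]

end SDE

/-! ### The drift at the bath site: closed form and an `N`-uniform second-moment bound -/

section Drift

variable (ω₂ lam β γ : ℝ) (N : ℕ)

/-- **Closed form of the drift at the right bath site**: `Y_N(q,p) = −U'(q_N) − [N ≥ 1] V'(q_N − q_{N−1}) − γ w_N p_N`,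
`U'(a) = ω₂a + lam a³`, `V'(r) = r + βr³`, `w_N = [N = 0] + 1` the bath multiplicity. [folklore] -/
theorem contactLoss_drift_last_eq (z : PhaseSpace (N + 1)) :
    ((pinnedChain ω₂ lam β γ).drift (N + 1) z).2 (Fin.last N) =
      -(ω₂ * z.1 (Fin.last N) + lam * z.1 (Fin.last N) ^ 3 +
          (if h : 0 < N then
            (z.1 (Fin.last N) - z.1 ⟨N - 1, by omega⟩) + β * (z.1 (Fin.last N) - z.1 ⟨N - 1, by omega⟩) ^ 3
          else 0)) -
        γ * bathWeight (N + 1) (Fin.last N) * z.2 (Fin.last N) := by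
  have hU : Differentiable ℝ (pinnedChain ω₂ lam β γ).U :=
    (pinnedChain_contDiff_U ω₂ lam β γ (n := 1)).differentiable one_ne_zero
  have hV : Differentiable ℝ (pinnedChain ω₂ lam β γ).V :=
    (pinnedChain_contDiff_V ω₂ lam β γ (n := 1)).differentiable one_ne_zero
  have hγ' : (pinnedChain ω₂ lam β γ).γ = γ := rfl
  simp only [OscillatorChain.drift, (pinnedChain ω₂ lam β γ).partialQ_hamiltonian_eq_dPotential hU hV, hγ',
    (pinnedChain ω₂ lam β γ).dPotential_eq_closed, pinnedChain_deriv_U, pinnedChain_deriv_V, Fin.val_last,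
    lt_self_iff_false, dif_neg, not_false_eq_true, sub_zero]

/-- `0 ≤ w_N ≤ 2` for the bath multiplicity of the last site. [folklore] -/
theorem contactLoss_bathWeight_last_le : 0 ≤ bathWeight (N + 1) (Fin.last N) ∧ bathWeight (N + 1) (Fin.last N) ≤ 2 := by
  unfold bathWeight
  constructor <;> split_ifs <;> norm_num

/-- The `N`-UNIFORM constant of the pointwise drift bound. [folklore] -/
theorem contactLoss_drift_last_sq_le (z : PhaseSpace (N + 1)) :
    ((pinnedChain ω₂ lam β γ).drift (N + 1) z).2 (Fin.last N) ^ 2 ≤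
      (8 * ω₂ ^ 2 + 16 + 8 * lam ^ 2 + 256 * β ^ 2 + 8 * γ ^ 2) *
        (z.1 (Fin.last N) ^ 2 + z.1 (Fin.last N) ^ 6 + z.1 ⟨N - 1, by omega⟩ ^ 2 + z.1 ⟨N - 1, by omega⟩ ^ 6 +
          z.2 (Fin.last N) ^ 2) := by
  rw [contactLoss_drift_last_eq]
  obtain ⟨hw0, hw2⟩ := contactLoss_bathWeight_last_le N
  set w := bathWeight (N + 1) (Fin.last N) with hw
  set a := z.1 (Fin.last N) with ha
  set a' := z.1 ⟨N - 1, by omega⟩ with ha'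
  set p := z.2 (Fin.last N) with hp
  set Vt : ℝ := (if h : 0 < N then (a - a') + β * (a - a') ^ 3 else 0) with hVt
  -- elementary squares
  have hU2 : (ω₂ * a + lam * a ^ 3) ^ 2 ≤ 2 * ω₂ ^ 2 * a ^ 2 + 2 * lam ^ 2 * a ^ 6 := by
    nlinarith [sq_nonneg (ω₂ * a - lam * a ^ 3)]
  have hr2 : (a - a') ^ 2 ≤ 2 * a ^ 2 + 2 * a' ^ 2 := by nlinarith [sq_nonneg (a + a')]
  have hx : 0 ≤ a ^ 2 := sq_nonneg a
  have hy : 0 ≤ a' ^ 2 := sq_nonneg a'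
  have hcube : (a ^ 2 + a' ^ 2) ^ 3 ≤ 4 * (a ^ 6 + a' ^ 6) := by
    nlinarith [mul_nonneg (sq_nonneg (a ^ 2 - a' ^ 2)) (add_nonneg hx hy), mul_nonneg hx hy]
  have hr6 : (a - a') ^ 6 ≤ 32 * (a ^ 6 + a' ^ 6) := by
    have h1 : (a - a') ^ 6 = ((a - a') ^ 2) ^ 3 := by ring
    have h2 : ((a - a') ^ 2) ^ 3 ≤ (2 * a ^ 2 + 2 * a' ^ 2) ^ 3 :=
      pow_le_pow_left₀ (sq_nonneg _) hr2 3
    have h3 : (2 * a ^ 2 + 2 * a' ^ 2) ^ 3 = 8 * (a ^ 2 + a' ^ 2) ^ 3 := by ring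
    nlinarith [h2, h3, hcube]
  have hV2 : Vt ^ 2 ≤ 2 * (a - a') ^ 2 + 2 * β ^ 2 * (a - a') ^ 6 := by
    by_cases hN : 0 < N
    · simp only [hVt, hN, dif_pos]
      nlinarith [sq_nonneg ((a - a') - β * (a - a') ^ 3)]
    · simp only [hVt, hN, dif_neg, not_false_eq_true]
      have : 0 ≤ (a - a') ^ 6 := by positivity
      nlinarith [sq_nonneg (a - a')]
  have hVt' : Vt ^ 2 ≤ 4 * a ^ 2 + 4 * a' ^ 2 + 64 * β ^ 2 * (a ^ 6 + a' ^ 6) := by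
    have hβ2 : 0 ≤ β ^ 2 := sq_nonneg β
    nlinarith [hV2, hr2, mul_le_mul_of_nonneg_left hr6 hβ2]
  -- the drift squared
  have hsplit : (-(ω₂ * a + lam * a ^ 3 + Vt) - γ * w * p) ^ 2 ≤
      4 * (ω₂ * a + lam * a ^ 3) ^ 2 + 4 * Vt ^ 2 + 2 * (γ * w * p) ^ 2 := by
    nlinarith [sq_nonneg ((ω₂ * a + lam * a ^ 3 + Vt) - γ * w * p), sq_nonneg ((ω₂ * a + lam * a ^ 3) - Vt)]
  have hwp : (γ * w * p) ^ 2 ≤ 4 * γ ^ 2 * p ^ 2 := by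
    have : w ^ 2 ≤ 4 := by nlinarith
    have hγp : 0 ≤ γ ^ 2 * p ^ 2 := by positivity
    nlinarith
  have ha6 : 0 ≤ a ^ 6 := by positivity
  have ha'6 : 0 ≤ a' ^ 6 := by positivity
  have hp2 : 0 ≤ p ^ 2 := sq_nonneg p
  nlinarith [hsplit, hU2, hVt', hwp, mul_nonneg (sq_nonneg ω₂) hy, mul_nonneg (sq_nonneg lam) hy,
    mul_nonneg (sq_nonneg lam) ha'6, mul_nonneg (sq_nonneg γ) hx, mul_nonneg (sq_nonneg γ) hy,
    mul_nonneg (sq_nonneg γ) ha6, mul_nonneg (sq_nonneg γ) ha'6, mul_nonneg (sq_nonneg β) hx,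
    mul_nonneg (sq_nonneg β) hy, mul_nonneg (sq_nonneg β) hp2, mul_nonneg (sq_nonneg ω₂) ha6,
    mul_nonneg (sq_nonneg ω₂) ha'6, mul_nonneg (sq_nonneg ω₂) hp2, mul_nonneg (sq_nonneg lam) hx,
    mul_nonneg (sq_nonneg lam) hp2]

/-- The drift at the bath site is continuous (hence measurable). [folklore] -/
theorem contactLoss_continuous_drift_last :
    Continuous fun z : PhaseSpace (N + 1) => ((pinnedChain ω₂ lam β γ).drift (N + 1) z).2 (Fin.last N) := by
  have h := (pinnedChain_contDiff_drift ω₂ lam β γ (N + 1) (n := 0)).continuous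
  exact (continuous_apply (Fin.last N)).comp (continuous_snd.comp h)

variable {ω₂ lam β γ} (hω : 0 < ω₂) (hl : 0 ≤ lam) (hβ : 0 ≤ β) {T : ℝ} (hT : 0 < T)
include hω hl hβ hT

omit N in
/-- **`N`-uniform second Gibbs moment of the bath-site drift**: there is `D² = D²(ω₂, lam, β, γ, T)` with
`Y_N ∈ L²(μ₀)` and `‖Y_N‖²_{L²(μ₀)} ≤ D²` for EVERY `N` (the `N`-uniform position moments `q², q⁶` at the two last
sites and equipartition `∫ p_N² dμ₀ = T`). [folklore] -/
theorem contactLoss_drift_last_sq_gibbs :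
    ∃ Dsq : ℝ, 0 ≤ Dsq ∧ ∀ N : ℕ,
      Integrable (fun z : PhaseSpace (N + 1) => ((pinnedChain ω₂ lam β γ).drift (N + 1) z).2 (Fin.last N) ^ 2)
          ((pinnedChain ω₂ lam β γ).gibbsMeasure (N + 1) T) ∧
        ∫ z, ((pinnedChain ω₂ lam β γ).drift (N + 1) z).2 (Fin.last N) ^ 2
            ∂((pinnedChain ω₂ lam β γ).gibbsMeasure (N + 1) T) ≤ Dsq := by
  obtain ⟨C₁, hC₁⟩ := lightCone_gibbs_position_moments ω₂ lam β γ hω hl hβ T hT 1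
  obtain ⟨C₃, hC₃⟩ := lightCone_gibbs_position_moments ω₂ lam β γ hω hl hβ T hT 3
  set A : ℝ := 8 * ω₂ ^ 2 + 16 + 8 * lam ^ 2 + 256 * β ^ 2 + 8 * γ ^ 2 with hA
  have hA0 : 0 ≤ A := by positivity
  refine ⟨A * (|C₁| + |C₃| + |C₁| + |C₃| + T), by positivity, fun N => ?_⟩
  obtain ⟨hi1, hb1⟩ := hC₁ N (Fin.last N)
  obtain ⟨hi3, hb3⟩ := hC₃ N (Fin.last N)
  obtain ⟨hi1', hb1'⟩ := hC₁ N ⟨N - 1, by omega⟩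
  obtain ⟨hi3', hb3'⟩ := hC₃ N ⟨N - 1, by omega⟩
  obtain ⟨hip, hbp⟩ := commonPastBound_gibbsEvenMoments ω₂ lam β γ hω hl hβ T hT (N + 1) (Fin.last N) 1
  simp only [Nat.mul_one] at hi1 hb1 hi1' hb1' hip hbp
  simp only [show 2 * 3 = 6 by norm_num] at hi3 hb3 hi3' hb3'
  simp only [pow_one, Finset.range_one, Finset.prod_singleton, Nat.cast_zero, mul_zero, zero_add, mul_one] at hbp
  -- the dominating integrable function
  set G : PhaseSpace (N + 1) → ℝ := fun z =>
    A * (z.1 (Fin.last N) ^ 2 + z.1 (Fin.last N) ^ 6 + z.1 ⟨N - 1, by omega⟩ ^ 2 + z.1 ⟨N - 1, by omega⟩ ^ 6 +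
      z.2 (Fin.last N) ^ 2) with hG
  set μ₀ := (pinnedChain ω₂ lam β γ).gibbsMeasure (N + 1) T with hμ₀
  have h12 : Integrable (fun z : PhaseSpace (N + 1) => z.1 (Fin.last N) ^ 2 + z.1 (Fin.last N) ^ 6) μ₀ :=
    hi1.add hi3
  have h123 : Integrable (fun z : PhaseSpace (N + 1) =>
      z.1 (Fin.last N) ^ 2 + z.1 (Fin.last N) ^ 6 + z.1 ⟨N - 1, by omega⟩ ^ 2) μ₀ := h12.add hi1'
  have h1234 : Integrable (fun z : PhaseSpace (N + 1) =>
      z.1 (Fin.last N) ^ 2 + z.1 (Fin.last N) ^ 6 + z.1 ⟨N - 1, by omega⟩ ^ 2 + z.1 ⟨N - 1, by omega⟩ ^ 6) μ₀ :=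
    h123.add hi3'
  have h12345 : Integrable (fun z : PhaseSpace (N + 1) =>
      z.1 (Fin.last N) ^ 2 + z.1 (Fin.last N) ^ 6 + z.1 ⟨N - 1, by omega⟩ ^ 2 + z.1 ⟨N - 1, by omega⟩ ^ 6 +
        z.2 (Fin.last N) ^ 2) μ₀ := h1234.add hip
  set G : PhaseSpace (N + 1) → ℝ := fun z =>
    A * (z.1 (Fin.last N) ^ 2 + z.1 (Fin.last N) ^ 6 + z.1 ⟨N - 1, by omega⟩ ^ 2 + z.1 ⟨N - 1, by omega⟩ ^ 6 +
      z.2 (Fin.last N) ^ 2) with hG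
  have hGi : Integrable G μ₀ := h12345.const_mul A
  have hdom : ∀ z, ((pinnedChain ω₂ lam β γ).drift (N + 1) z).2 (Fin.last N) ^ 2 ≤ G z :=
    fun z => contactLoss_drift_last_sq_le ω₂ lam β γ N z
  have hmeas : AEStronglyMeasurable
      (fun z : PhaseSpace (N + 1) => ((pinnedChain ω₂ lam β γ).drift (N + 1) z).2 (Fin.last N) ^ 2) μ₀ :=
    ((contactLoss_continuous_drift_last ω₂ lam β γ N).pow 2).aestronglyMeasurable
  have hint : Integrable
      (fun z : PhaseSpace (N + 1) => ((pinnedChain ω₂ lam β γ).drift (N + 1) z).2 (Fin.last N) ^ 2) μ₀ :=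
    hGi.mono' hmeas (Eventually.of_forall fun z => by
      rw [Real.norm_of_nonneg (sq_nonneg _)]; exact hdom z)
  refine ⟨hint, ?_⟩
  have hsum : ∫ z, G z ∂μ₀ = A * ((∫ z, z.1 (Fin.last N) ^ 2 ∂μ₀) + (∫ z, z.1 (Fin.last N) ^ 6 ∂μ₀) +
          (∫ z, z.1 (⟨N - 1, by omega⟩ : Fin (N + 1)) ^ 2 ∂μ₀) +
          (∫ z, z.1 (⟨N - 1, by omega⟩ : Fin (N + 1)) ^ 6 ∂μ₀) + ∫ z, z.2 (Fin.last N) ^ 2 ∂μ₀) := by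
    simp only [hG]
    rw [integral_const_mul, integral_add h1234 hip, integral_add h123 hi3', integral_add h12 hi1',
      integral_add hi1 hi3]
  calc ∫ z, ((pinnedChain ω₂ lam β γ).drift (N + 1) z).2 (Fin.last N) ^ 2 ∂μ₀
      ≤ ∫ z, G z ∂μ₀ := integral_mono hint hGi hdom
    _ = _ := hsum
    _ ≤ A * (|C₁| + |C₃| + |C₁| + |C₃| + T) := by
        refine mul_le_mul_of_nonneg_left ?_ hA0
        rw [hbp]
        linarith [le_abs_self C₁, le_abs_self C₃]

end Drift

/-- **`N`-UNIFORM GIBBS SECOND MOMENT OF THE BATH-SITE DRIFT** (registered sub-goal, closed form of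
`contactLoss_drift_last_sq_gibbs`): for `ω₂ > 0`, `lam, β ≥ 0`, `T > 0` there is `D² ≥ 0` with
`Y_N ∈ L²(μ₀)` and `‖Y_N‖²_{L²(μ₀)} ≤ D²` for EVERY `N`, `Y_N = −U'(q_N) − [N ≥ 1]V'(q_N − q_{N−1}) − γ w_N p_N` the
drift at the bath site (the input of the `N`-uniform contact-loss theorem for `stub_forecastLoss`, line
`two-horizons-forecast-loss`). [folklore] -/
theorem contactLoss_driftSecondMoment : ∀ ω₂ lam β γ : ℝ, 0 < ω₂ → 0 ≤ lam → 0 ≤ β → ∀ T : ℝ, 0 < T → ∃ Dsq : ℝ, 0 ≤ Dsq ∧ ∀ N : ℕ, Integrable (fun z : PhaseSpace (N + 1) => ((pinnedChain ω₂ lam β γ).drift (N + 1) z).2 (Fin.last N) ^ 2) ((pinnedChain ω₂ lam β γ).gibbsMeasure (N + 1) T) ∧ ∫ z, ((pinnedChain ω₂ lam β γ).drift (N + 1) z).2 (Fin.last N) ^ 2 ∂((pinnedChain ω₂ lam β γ).gibbsMeasure (N + 1) T) ≤ Dsq :=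
  fun _ _ _ _ hω hl hβ _ hT => contactLoss_drift_last_sq_gibbs hω hl hβ hT

end Summit.AtomisticToContinuum.FouriersLaw.Theorems.PhononMeanFreePath

end
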